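import Summits.Ventures.PercRepro.C025ProfileGirthSuccSuccDualProof

/-!
# THE DUAL INEQUALITY AT EVERY LEVEL (night-3 g20)

The induction of `dual_count` works at every level `q + j`:
**THEOREM (`dual_count_all`).** For every finite matroid in which every set of at most `q` points is independent, every
`A ⊆ E` with `m` points and every `p ≤ ρ(A)` with `q + j ≤ p`: `C(p, j) · C(m − j, q) ≤ C(q+j, j) · #{independent
(q+j)-subsets of A}` — the density of independent `(q+j)`-sets of `A` is at least the density `C(p,j)/C(m,j)` of the
`j`-subsets of a basis.  Induction on `q` (for fixed `q` on `m`): a basis `Z` of a dependent `A` and `x ∈ A ∖ Z` split the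
independent `(q+1+j)`-subsets of `A` into those of `A ∖ x` and the sets `U ∪ {x}` with `U` independent in `M ／ {x}`;
`(q+1+j) · C(p−1, j) ≥ (q+1) · C(p, j)` exactly when `p ≥ q + 1 + j` (`choose_pred_mul_ge`), `(q+1+j) · C(q+j, j) = (q+1) ·
C(q+1+j, j)` and Pascal close; the free case is `C(m, j) · C(m−j, q+1) = C(q+1+j, j) · C(m, q+1+j)`.  With
`choose_add_mul_choose_eq`: `C(p+q, q+j) · C(q+j, j) = C(p+q, q) · C(p, j)`.  The thin half of every row is in the companion
module `C025ProfileGirthThinAll`.  No `def`, no `instance`, no notation.  Axioms: standard.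
-/

open scoped Matroid

namespace PercRepro

open Set Finset ThmH Staged

namespace GirthRows

variable {α : Type} [DecidableEq α]

/-- `C(p+q, q+j) · C(q+j, j) = C(p+q, q) · C(p, j)`. -/
theorem choose_add_mul_choose_eq (p q j : ℕ) :
    (p + q).choose (q + j) * (q + j).choose j = (p + q).choose q * p.choose j := by
  rcases Nat.lt_or_ge p j with hp | hp
  · have h1 : (p + q).choose (q + j) = 0 := Nat.choose_eq_zero_of_lt (by omega)
    have h2 : p.choose j = 0 := Nat.choose_eq_zero_of_lt hp
    rw [h1, h2, zero_mul, mul_zero]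
  · have h1 := Nat.choose_mul (n := p + q) (k := q + j) (s := j) (by omega)
    have h2 := Nat.choose_mul (n := p + q) (k := p) (s := j) hp
    have e1 : p + q - j = p - j + q := by omega
    have e2 : q + j - j = q := by omega
    rw [e1, e2] at h1
    have e3 : p + q - j = p - j + q := by omega
    rw [e3] at h2
    have h3 : (p + q).choose p = (p + q).choose q := Nat.choose_symm_add
    have h4 : (p - j + q).choose (p - j) = (p - j + q).choose q := Nat.choose_symm_add
    rw [h3, h4] at h2
    rw [h1, ← h2]

/-- `(q+1+j) · C(p−1, j) ≥ (q+1) · C(p, j)` when `p ≥ q + 1 + j`. -/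
theorem choose_pred_mul_ge (p q j : ℕ) (hp : q + 1 + j ≤ p) :
    (q + 1) * p.choose j ≤ (q + 1 + j) * (p - 1).choose j := by
  have hp1 : 1 ≤ p := by omega
  have hid := Nat.choose_mul_succ_eq (p - 1) j
  have e1 : p - 1 + 1 = p := by omega
  rw [e1] at hid
  -- `C(p−1, j) · p = C(p, j) · (p − j)`
  have hkey : (q + 1 + j) * (p - j) ≥ (q + 1) * p := by
    have : (q + 1 + j) * (p - j) = (q + 1) * p + j * (p - (q + 1 + j)) := by
      have hpj : p = (p - j) + j := by omega
      have hpq : p - j = (p - (q + 1 + j)) + (q + 1) := by omega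
      zify [hp, hp1, (by omega : j ≤ p), (by omega : q + 1 + j ≤ p)]
      ring
    omega
  have h2 : (q + 1) * p.choose j * p ≤ (q + 1 + j) * (p - 1).choose j * p := by
    calc (q + 1) * p.choose j * p = p.choose j * ((q + 1) * p) := by ring
      _ ≤ p.choose j * ((q + 1 + j) * (p - j)) := Nat.mul_le_mul_left _ hkey
      _ = (q + 1 + j) * (p.choose j * (p - j)) := by ring
      _ = (q + 1 + j) * ((p - 1).choose j * p) := by rw [hid]
      _ = (q + 1 + j) * (p - 1).choose j * p := by ring
  exact Nat.le_of_mul_le_mul_right h2 (by omega)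

open scoped Classical in
/-- **THE DUAL INEQUALITY AT LEVEL `q + j`** (`dual_count_all`). -/
theorem dual_count_all (j q : ℕ) : ∀ (M : Matroid α) [M.Finite] (A : Finset α), A ⊆ gr M →
    (∀ T ⊆ M.E, T.encard ≤ q → M.Indep T) → ∀ p : ℕ, ((p : ℕ) : ℕ∞) ≤ M.eRk (A : Set α) → q + j ≤ p →
    p.choose j * (A.card - j).choose q ≤
      (q + j).choose j * ((A.powersetCard (q + j)).filter (fun U : Finset α => M.Indep (U : Set α))).card := by
  induction q with
  | zero =>
    intro M _ A hAg _ p hp hqp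
    have hAE : (A : Set α) ⊆ M.E := by rw [← coe_gr]; exact_mod_cast hAg
    obtain ⟨Z, hZ⟩ := M.exists_isBasis (A : Set α) hAE
    have hpZ : ((p : ℕ) : ℕ∞) ≤ Z.encard := by rw [hZ.encard_eq_eRk]; exact hp
    obtain ⟨Z₀, hZ₀Z, hZ₀c⟩ := Set.exists_subset_encard_eq hpZ
    have hfin : Z₀.Finite := Set.finite_of_encard_eq_coe hZ₀c
    have hZ₀i : M.Indep Z₀ := hZ.indep.subset hZ₀Z
    have hZ₀A : hfin.toFinset ⊆ A := by
      rw [Set.Finite.toFinset_subset]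
      exact hZ₀Z.trans hZ.subset
    have hcard : hfin.toFinset.card = p := by
      have := hZ₀c
      rw [Set.Finite.encard_eq_coe_toFinset_card hfin] at this
      exact_mod_cast this
    have hsub : hfin.toFinset.powersetCard j ⊆ (A.powersetCard (0 + j)).filter (fun U : Finset α => M.Indep (U : Set α)) := by
      intro U hU
      rw [Finset.mem_powersetCard] at hU
      rw [Finset.mem_filter, Finset.mem_powersetCard]
      refine ⟨⟨hU.1.trans hZ₀A, by rw [hU.2]; omega⟩, ?_⟩
      apply hZ₀i.subset
      rw [← Set.Finite.coe_toFinset hfin]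
      exact_mod_cast hU.1
    have := Finset.card_le_card hsub
    rw [Finset.card_powersetCard, hcard] at this
    simpa using this
  | succ q ihq =>
    intro M _ A
    suffices h : ∀ k, ∀ (M : Matroid α) [M.Finite] (A : Finset α), A.card = k → A ⊆ gr M →
        (∀ T ⊆ M.E, T.encard ≤ (q + 1 : ℕ) → M.Indep T) → ∀ p : ℕ, ((p : ℕ) : ℕ∞) ≤ M.eRk (A : Set α) →
        q + 1 + j ≤ p →
        p.choose j * (A.card - j).choose (q + 1) ≤
          (q + 1 + j).choose j * ((A.powersetCard (q + 1 + j)).filter (fun U : Finset α => M.Indep (U : Set α))).card from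
      h A.card M A rfl
    intro k
    induction k using Nat.strong_induction_on with
    | _ k ihk =>
    intro M _ A hk hAg hg p hp hqp
    have hAE : (A : Set α) ⊆ M.E := by rw [← coe_gr]; exact_mod_cast hAg
    have hpA : p ≤ A.card := by
      have h1 : ((p : ℕ) : ℕ∞) ≤ ((A.card : ℕ) : ℕ∞) := by
        refine hp.trans ?_
        rw [← Set.encard_coe_eq_coe_finsetCard]
        exact M.eRk_le_encard _
      exact_mod_cast h1
    by_cases hAi : M.Indep (A : Set α)
    · have hall : (A.powersetCard (q + 1 + j)).filter (fun U : Finset α => M.Indep (U : Set α)) =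
          A.powersetCard (q + 1 + j) := by
        apply Finset.filter_true_of_mem
        intro U hU
        exact hAi.subset (Finset.coe_subset.2 (Finset.mem_powersetCard.1 hU).1)
      rw [hall, Finset.card_powersetCard]
      have hid := Nat.choose_mul (n := A.card) (k := q + 1 + j) (s := j) (by omega)
      have h3 : q + 1 + j - j = q + 1 := by omega
      rw [h3] at hid
      calc p.choose j * (A.card - j).choose (q + 1) ≤ A.card.choose j * (A.card - j).choose (q + 1) :=
            Nat.mul_le_mul_right _ (Nat.choose_le_choose j hpA)
        _ = A.card.choose (q + 1 + j) * (q + 1 + j).choose j := hid.symm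
        _ = (q + 1 + j).choose j * A.card.choose (q + 1 + j) := mul_comm _ _
    · obtain ⟨Z, hZ⟩ := M.exists_isBasis (A : Set α) hAE
      have hZne : Z ≠ (A : Set α) := fun h => hAi (h ▸ hZ.indep)
      obtain ⟨x, hxA, hxZ⟩ : ∃ x ∈ A, x ∉ Z := by
        by_contra hcon
        push Not at hcon
        apply hZne
        apply Set.Subset.antisymm hZ.subset
        intro z hz
        exact hcon z (Finset.mem_coe.1 hz)
      set A' := A.erase x with hA'
      have hA'g : A' ⊆ gr M := (Finset.erase_subset _ _).trans hAg
      have hA'c : A'.card = k - 1 := by rw [hA', Finset.card_erase_of_mem hxA, hk]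
      have hk1 : 1 ≤ k := by rw [← hk]; exact Finset.card_pos.2 ⟨x, hxA⟩
      have hxE : x ∈ M.E := hAE (Finset.mem_coe.2 hxA)
      have hxi : M.Indep ({x} : Set α) := by
        apply hg _ (Set.singleton_subset_iff.2 hxE)
        rw [Set.encard_singleton]
        exact_mod_cast (by omega : 1 ≤ q + 1)
      have hZA' : Z ⊆ (A' : Set α) := by
        intro z hz
        rw [hA', Finset.coe_erase]
        exact ⟨hZ.subset hz, fun h => hxZ (h ▸ hz)⟩
      have hp' : ((p : ℕ) : ℕ∞) ≤ M.eRk (A' : Set α) := by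
        refine hp.trans ?_
        rw [← hZ.encard_eq_eRk]
        exact hZ.indep.encard_le_eRk_of_subset hZA'
      have h1 := ihk (k - 1) (by omega) M A' hA'c hA'g hg p hp' hqp
      haveI : (M ／ ({x} : Set α)).Finite := Matroid.contract_finite
      have hgrC : A' ⊆ gr (M ／ ({x} : Set α)) := by
        rw [← Finset.coe_subset, coe_gr, Matroid.contract_ground, hA', Finset.coe_erase]
        exact Set.sdiff_subset_sdiff_left hAE
      have hgC : ∀ T ⊆ (M ／ ({x} : Set α)).E, T.encard ≤ (q : ℕ) → (M ／ ({x} : Set α)).Indep T := by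
        intro T hT hTc
        rw [Matroid.contract_ground] at hT
        rw [hxi.contract_indep_iff]
        have hxT : x ∉ T := fun h => (hT h).2 rfl
        refine ⟨Set.disjoint_singleton_right.2 hxT, ?_⟩
        apply hg
        · exact Set.union_subset (hT.trans Set.sdiff_subset) (Set.singleton_subset_iff.2 hxE)
        · rw [Set.union_singleton, Set.encard_insert_of_notMem hxT]
          calc T.encard + 1 ≤ (q : ℕ∞) + 1 := add_le_add hTc (le_refl 1)
            _ = ((q + 1 : ℕ) : ℕ∞) := by push_cast; rfl
      obtain ⟨Z₂, hZ₂, hxZ₂⟩ := hxi.subset_isBasis_of_subset (Set.singleton_subset_iff.2 (Finset.mem_coe.2 hxA)) hAE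
      have hxZ₂' : x ∈ Z₂ := hxZ₂ rfl
      have hZ₂i : (M ／ ({x} : Set α)).Indep (Z₂ \ {x}) := by
        rw [hxi.contract_indep_iff]
        refine ⟨Set.disjoint_sdiff_left, ?_⟩
        rw [Set.sdiff_union_of_subset (Set.singleton_subset_iff.2 hxZ₂')]
        exact hZ₂.indep
      have hZ₂A' : Z₂ \ {x} ⊆ (A' : Set α) := by
        rw [hA', Finset.coe_erase]
        exact Set.sdiff_subset_sdiff_left hZ₂.subset
      have hpC : (((p - 1 : ℕ) : ℕ) : ℕ∞) ≤ (M ／ ({x} : Set α)).eRk (A' : Set α) := by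
        refine le_trans ?_ (hZ₂i.encard_le_eRk_of_subset hZ₂A')
        have h1 := Set.encard_sdiff_singleton_add_one hxZ₂'
        rw [hZ₂.encard_eq_eRk] at h1
        have h2 : ((p : ℕ) : ℕ∞) ≤ (Z₂ \ {x}).encard + 1 := by rw [h1]; exact hp
        have h3 : ((p - 1 : ℕ) : ℕ∞) + 1 ≤ (Z₂ \ {x}).encard + 1 := by
          calc ((p - 1 : ℕ) : ℕ∞) + 1 = ((p - 1 + 1 : ℕ) : ℕ∞) := by push_cast; rfl
            _ = ((p : ℕ) : ℕ∞) := by congr 1; omega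
            _ ≤ (Z₂ \ {x}).encard + 1 := h2
        exact (ENat.add_le_add_iff_right (by simp)).1 h3
      have h2 := ihq (M ／ ({x} : Set α)) A' hgrC hgC (p - 1) hpC (by omega)
      have hsplit := card_filter_indep_powersetCard_split M A hxA (q + j)
      have hiff : ∀ U ∈ A'.powersetCard (q + j),
          M.Indep ((insert x U : Finset α) : Set α) ↔ (M ／ ({x} : Set α)).Indep (U : Set α) := by
        intro U hU
        rw [Finset.mem_powersetCard] at hU
        have hxU : x ∉ U := fun h => Finset.notMem_erase x A (hU.1 h)
        rw [hxi.contract_indep_iff, Finset.coe_insert, Set.union_singleton]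
        constructor
        · intro h
          exact ⟨Set.disjoint_singleton_right.2 (fun h' => hxU (Finset.mem_coe.1 h')), h⟩
        · intro h
          exact h.2
      have hcount : (((A'.powersetCard (q + j)).filter
          (fun U : Finset α => M.Indep ((insert x U : Finset α) : Set α))).card =
          ((A'.powersetCard (q + j)).filter (fun U : Finset α => (M ／ ({x} : Set α)).Indep (U : Set α))).card) := by
        congr 1
        exact Finset.filter_congr hiff
      have e0 : q + j + 1 = q + 1 + j := by omega
      rw [e0, hcount] at hsplit
      have hpas : (A.card - j).choose (q + 1) = (A'.card - j).choose (q + 1) + (A'.card - j).choose q := by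
        have hm : A.card - j = (A'.card - j) + 1 := by
          rw [hA'c, hk]
          omega
        rw [hm, Nat.choose_succ_succ', add_comm]
      have hq3 := choose_pred_mul_ge p q j hqp
      have hmain : (q + 1 + j).choose j * ((A'.powersetCard (q + j)).filter
          (fun U : Finset α => (M ／ ({x} : Set α)).Indep (U : Set α))).card ≥ p.choose j * (A'.card - j).choose q := by
        have hc1 : (q + 1 + j) * (q + j).choose j = (q + 1) * (q + 1 + j).choose j := by
          have := Nat.choose_mul_succ_eq (q + j) j
          have h3 : q + j + 1 - j = q + 1 := by omega
          have h4 : q + j + 1 = q + 1 + j := by omega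
          rw [h3, h4] at this
          rw [mul_comm, this, mul_comm]
        have h2' : (q + 1 + j) * ((q + j).choose j * ((A'.powersetCard (q + j)).filter
            (fun U : Finset α => (M ／ ({x} : Set α)).Indep (U : Set α))).card) ≥
            (q + 1 + j) * ((p - 1).choose j * (A'.card - j).choose q) := Nat.mul_le_mul_left _ h2
        have h3 : (q + 1) * ((q + 1 + j).choose j * ((A'.powersetCard (q + j)).filter
            (fun U : Finset α => (M ／ ({x} : Set α)).Indep (U : Set α))).card) ≥
            (q + 1) * (p.choose j * (A'.card - j).choose q) := by
          calc (q + 1) * ((q + 1 + j).choose j * _) = (q + 1 + j) * ((q + j).choose j * _) := by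
                rw [← mul_assoc, ← hc1, mul_assoc]
            _ ≥ (q + 1 + j) * ((p - 1).choose j * (A'.card - j).choose q) := h2'
            _ = ((q + 1 + j) * (p - 1).choose j) * (A'.card - j).choose q := by ring
            _ ≥ ((q + 1) * p.choose j) * (A'.card - j).choose q := Nat.mul_le_mul_right _ hq3
            _ = (q + 1) * (p.choose j * (A'.card - j).choose q) := by ring
        exact Nat.le_of_mul_le_mul_left h3 (by omega)
      rw [hpas, Nat.mul_add, hsplit, Nat.mul_add]
      exact Nat.add_le_add h1 hmain


end GirthRows

end PercRepro
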